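import Mathlib
import Literature.Computability.AlgebraicComplexity.KoszulFlatteningKronecker
import Summits.MatrixMultiplication.MatrixMultiplication.Theses.DesignFlattening

/-!
# `DesignFlattening.WeylSeparableFloor` (stmt-MatrixMultiplication-8040) — proved

Route `DesignFlattening`, support item #9 `WeylSeparableFloor`: every separable `n`-term toric
design (over the `ℤ₂²` addition table `[b + c = a]`) of the `k`-th Kronecker power of the
Weyl-twisted table `T(a; b, c) = [b + c = a] · (-1)^{b₂ c₁}` has `n ≥ (3/2)^k`.

## Proof (the route card's "odd-twist hexagon move", made carry-free)

Cells of the table are indexed by `(b, c) ∈ G × G`, `G = ℤ₂ × ℤ₂` (then `a = b + c`).  The two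
triples `A = {(01,10), (00,01), (10,00)}` and `B = {(01,00), (00,10), (10,01)}` have the same
multisets of `a`-, `b`- and `c`-coordinates (a degree-3 binomial "move" of the toric design
variety), and the twist `(-1)^{b₂c₁}` is `-1` on exactly one of the six cells (`(01,10) ∈ A`).
The signed `3 × 3` selection `L(x) = [[x_{A₁}, x_{B₁}, 0], [0, x_{A₂}, x_{B₂}], [-x_{B₃}, 0, x_{A₃}]]`
has `det L(x) = x^A - x^B`, hence `det = 0` (rank `≤ 2`) at every toric point
`x(a; b, c) = [b + c = a] u(a) v(b) w(c)`, while `det L(T) = -2 ≠ 0` (rank `3`).  Selecting entries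
commutes with Kronecker products, so the design identity `T^{⊗k} = Σ_j ⊗_i t_{ji}` gives
`L(T)^{⊗k} = Σ_j ⊗_i L(t_{ji})` as `3^k × 3^k` matrices; ranks: `3^k ≤ Σ_j Π_i 2 = n · 2^k`.

Tools: `powMatrix`, `isUnit_powMatrix`, `matRank_kroneckerMap_mul`
(`Literature/Computability/AlgebraicComplexity/KoszulFlatteningKronecker.lean`), Mathlib's
`Matrix.rank_of_isUnit`, `Matrix.rank_reindex`, `Matrix.exists_mulVec_eq_zero_iff`,
`Matrix.det_fin_three`.  The file is definition-free: the heterogeneous Kronecker product is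
written `Matrix.of fun b c => ∏ l, M l (b l) (c l)`.
-/

open Literature.Computability.AlgebraicComplexity

namespace Summit.MatrixMultiplication.MatrixMultiplication.Theorems

namespace DesignFlatteningWeylSeparableFloor

/-- Sub-additivity of matrix rank over `ℂ`: `rank (A + B) ≤ rank A + rank B`. [folklore] -/
theorem rank_add_le {m n : Type*} [Fintype m] [Fintype n] (A B : Matrix m n ℂ) :
    (A + B).rank ≤ A.rank + B.rank := by
  unfold Matrix.rank
  rw [Matrix.mulVecLin_add]
  exact (Submodule.finrank_mono (LinearMap.range_add_le _ _)).trans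
    (Submodule.finrank_add_le_finrank_add_finrank _ _)

/-- Sub-additivity of matrix rank over finite sums. [folklore] -/
theorem rank_sum_le {m n ι : Type*} [Fintype m] [Fintype n] (s : Finset ι)
    (A : ι → Matrix m n ℂ) : (∑ j ∈ s, A j).rank ≤ ∑ j ∈ s, (A j).rank :=
  Finset.le_sum_of_subadditive (fun M : Matrix m n ℂ => M.rank) Matrix.rank_zero.le rank_add_le
    s A

/-- A singular `3 × 3` complex matrix has rank at most `2` (rank–nullity). [folklore] -/
theorem rank_le_two_of_det_eq_zero (A : Matrix (Fin 3) (Fin 3) ℂ) (h : A.det = 0) :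
    A.rank ≤ 2 := by
  obtain ⟨v, hv, hAv⟩ := Matrix.exists_mulVec_eq_zero_iff.mpr h
  have h1 := LinearMap.finrank_range_add_finrank_ker A.mulVecLin
  rw [Module.finrank_fintype_fun_eq_card, Fintype.card_fin] at h1
  have hmem : v ∈ LinearMap.ker A.mulVecLin := by
    rw [LinearMap.mem_ker, Matrix.mulVecLin_apply]
    exact hAv
  have h2 : 1 ≤ Module.finrank ℂ (LinearMap.ker A.mulVecLin) := by
    rw [← finrank_span_singleton (K := ℂ) hv]
    exact Submodule.finrank_mono ((Submodule.span_singleton_le_iff_mem v _).mpr hmem)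
  unfold Matrix.rank
  omega

/-- Rank is multiplicative on heterogeneous Kronecker products `⊗_l M_l` of `3 × 3` matrices,
indexed by `Fin N → Fin 3`: `rank (⊗_l M_l) = Π_l rank M_l`. [folklore] -/
theorem rank_piKronecker : ∀ (N : ℕ) (M : Fin N → Matrix (Fin 3) (Fin 3) ℂ),
    (Matrix.of fun b c : Fin N → Fin 3 => ∏ l, M l (b l) (c l)).rank = ∏ l, (M l).rank
  | 0, M => by
      have h : (Matrix.of fun b c : Fin 0 → Fin 3 => ∏ l, M l (b l) (c l)) = 1 := by
        ext b c
        simp [Matrix.one_apply, Subsingleton.elim b c]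
      rw [h, Matrix.rank_one, Fintype.card_fun, Fintype.card_fin, Fintype.card_fin]
      simp
  | N + 1, M => by
      have key : Matrix.reindex (Fin.consEquiv fun _ : Fin (N + 1) => Fin 3).symm
            (Fin.consEquiv fun _ : Fin (N + 1) => Fin 3).symm
            (Matrix.of fun b c : Fin (N + 1) → Fin 3 => ∏ l, M l (b l) (c l)) =
          Matrix.kroneckerMap (· * ·) (M 0)
            (Matrix.of fun b c : Fin N → Fin 3 => ∏ l, M l.succ (b l) (c l)) := by
        ext ⟨x, b⟩ ⟨y, c⟩
        simp [Matrix.reindex_apply, Fin.prod_univ_succ]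
      rw [← Matrix.rank_reindex (Fin.consEquiv fun _ : Fin (N + 1) => Fin 3).symm
        (Fin.consEquiv fun _ : Fin (N + 1) => Fin 3).symm, key, matRank_kroneckerMap_mul,
        rank_piKronecker N, Fin.prod_univ_succ]

/-- **The design-flattening bound, abstract form.** Let `e : Fin 3 → Fin 3 → ι` select cells and
`σ : Fin 3 → Fin 3 → ℂ` be signs, so that `x ↦ L(x) = (σ_{rs} x_{e(r,s)})` is a linear map from
`ι`-arrays to `3 × 3` matrices.  If `⊗_i T = Σ_{j<n} ⊗_{i<k} t_{ji}` entrywise on `Fin k → ι`,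
`L(T)` is invertible and every `L(t_{ji})` has rank `≤ 2`, then `3^k ≤ n · 2^k`
(apply `L^{⊗k}`: `L(T)^{⊗k} = Σ_j ⊗_i L(t_{ji})`, and compare ranks). [folklore] -/
theorem three_pow_le_of_design {ι : Type*} (e : Fin 3 → Fin 3 → ι) (σ : Fin 3 → Fin 3 → ℂ)
    {k n : ℕ} (T : ι → ℂ) (t : Fin n → Fin k → ι → ℂ)
    (hdesign : ∀ x : Fin k → ι, ∏ i, T (x i) = ∑ j, ∏ i, t j i (x i))
    (hT : IsUnit (Matrix.of fun r s : Fin 3 => σ r s * T (e r s)))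
    (ht : ∀ j i, (Matrix.of fun r s : Fin 3 => σ r s * t j i (e r s)).rank ≤ 2) :
    3 ^ k ≤ n * 2 ^ k := by
  -- the flattened design identity `L(T)^{⊗k} = Σ_j ⊗_i L(t_{ji})`
  have hflat : powMatrix (Matrix.of fun r s : Fin 3 => σ r s * T (e r s)) k =
      ∑ j, Matrix.of (fun b c : Fin k → Fin 3 =>
        ∏ l, (Matrix.of fun r s : Fin 3 => σ r s * t j l (e r s)) (b l) (c l)) := by
    ext b c
    rw [powMatrix_apply, Matrix.sum_apply]
    simp only [Matrix.of_apply]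
    rw [Finset.prod_mul_distrib, hdesign (fun l => e (b l) (c l)), Finset.mul_sum]
    refine Finset.sum_congr rfl fun j _ => ?_
    rw [Finset.prod_mul_distrib]
  -- rank of the left-hand side
  have h1 : (powMatrix (Matrix.of fun r s : Fin 3 => σ r s * T (e r s)) k).rank = 3 ^ k := by
    rw [Matrix.rank_of_isUnit _ (isUnit_powMatrix hT k), Fintype.card_fun, Fintype.card_fin,
      Fintype.card_fin]
  -- rank of the right-hand side
  have h2 : (∑ j, Matrix.of (fun b c : Fin k → Fin 3 =>
        ∏ l, (Matrix.of fun r s : Fin 3 => σ r s * t j l (e r s)) (b l) (c l))).rank ≤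
      n * 2 ^ k := by
    refine (rank_sum_le _ _).trans ?_
    calc ∑ j, (Matrix.of (fun b c : Fin k → Fin 3 =>
            ∏ l, (Matrix.of fun r s : Fin 3 => σ r s * t j l (e r s)) (b l) (c l))).rank
        = ∑ j, ∏ l, (Matrix.of fun r s : Fin 3 => σ r s * t j l (e r s)).rank :=
          Finset.sum_congr rfl fun j _ => rank_piKronecker k _
      _ ≤ ∑ _j : Fin n, ∏ _l : Fin k, 2 :=
          Finset.sum_le_sum fun j _ => Finset.prod_le_prod (fun l _ => Nat.zero_le _)
            fun l _ => ht j l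
      _ = n * 2 ^ k := by simp
  rw [← h1, hflat]
  exact h2

end DesignFlatteningWeylSeparableFloor

open DesignFlatteningWeylSeparableFloor in
/-- **`WeylSeparableFloor`** (route `DesignFlattening`, item stmt-MatrixMultiplication-8040): every
separable `n`-term toric design over the `ℤ₂²` table of the `k`-th power of the Weyl-twisted
table `[b + c = a] · (-1)^{b₂ c₁}` has `(3/2)^k ≤ n`.  Proof: the carry-free odd-twist hexagon
move `A = {(01,10),(00,01),(10,00)}`, `B = {(01,00),(00,10),(10,01)}` in `(b,c)`-coordinates gives
a signed `3 × 3` selection `L` with `det L = x^A - x^B`: rank `≤ 2` on toric points,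
`det L(T) = -2`; then `three_pow_le_of_design`. [folklore] -/
theorem weylSeparableFloor_proof :
    Summit.MatrixMultiplication.MatrixMultiplication.Theses.DesignFlattening.WeylSeparableFloor := by
  unfold Summit.MatrixMultiplication.MatrixMultiplication.Theses.DesignFlattening.WeylSeparableFloor
  intro k n u v w h
  -- reduce to the integer inequality `3^k ≤ n · 2^k`
  suffices hk : 3 ^ k ≤ n * 2 ^ k by
    rw [div_pow, div_le_iff₀ (by positivity)]
    exact_mod_cast hk
  -- cells `(b, c)` of the table (`a = b + c` is forced); the selection `e` and the signs `σ`
  refine three_pow_le_of_design (ι := (ZMod 2 × ZMod 2) × (ZMod 2 × ZMod 2))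
    ![![((0, 1), (1, 0)), ((0, 1), (0, 0)), ((0, 0), (0, 0))],
      ![((0, 0), (0, 0)), ((0, 0), (0, 1)), ((0, 0), (1, 0))],
      ![((1, 0), (0, 1)), ((0, 0), (0, 0)), ((1, 0), (0, 0))]]
    ![![1, 1, 0], ![0, 1, 1], ![-1, 0, 1]]
    (fun bc => (-1 : ℂ) ^ ((bc.1.2 * bc.2.1).val))
    (fun j i bc => u j i (bc.1 + bc.2) * v j i bc.1 * w j i bc.2) ?_ ?_ ?_
  · -- the design identity on the table
    intro x
    have hx := h (fun i => (x i).1 + (x i).2) (fun i => (x i).1) (fun i => (x i).2)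
    simpa using hx
  · -- `L(T)` is invertible: `det = -2`
    rw [Matrix.isUnit_iff_isUnit_det, isUnit_iff_ne_zero]
    rw [Matrix.det_fin_three]
    simp [ZMod.val_one]
  · -- `L(t)` is singular at toric points
    intro j i
    apply rank_le_two_of_det_eq_zero
    rw [Matrix.det_fin_three]
    simp only [Matrix.cons_val', Matrix.cons_val_fin_one, Fin.isValue, Matrix.of_apply,
      Matrix.cons_val_zero, Prod.mk_add_mk, zero_add, add_zero, one_mul, Matrix.cons_val_one,
      Matrix.cons_val, zero_mul, mul_zero, sub_zero, neg_mul, mul_neg, neg_zero]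
    ring

end Summit.MatrixMultiplication.MatrixMultiplication.Theorems
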